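/-
Copyright (c) 2026. All rights reserved.
Released under Apache 2.0 license as described in the file LICENSE.
Authors: abc-iut cell, seat abc-iut-L6-t6 (gen 6; sequel to junction row «J-Fmod», proof-only).
-/
import Literature.IUT.LogThetaLattice.GlobalFrobenioidsFmodJunction
import HarnessLib

/-!
# Junction «J-Fmod», END TO END on `𝓕⊛_𝔪𝔬𝔡`: the composite `𝓕⊛_𝔪𝔬𝔡 ⥲ (†𝓕⊛_mod)_α ⥲ †ℱ^⊛_mod ⊆ †ℱ^⊛ ⥲ ℱ^⊛(†𝒟^⊚)`
# is the tautological functor on rational functions, Frobenius degrees and divisors (proof-only)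

S. Mochizuki, *Inter-universal Teichmüller Theory III*, Proposition 3.7 (ii) p. 110 l. 44–64: "natural
isomorphisms of Frobenioids `(†𝓕⊛_mod)_α ⥲ (†𝓕⊛_𝔪𝔬𝔡)_α` … that induce the tautological isomorphisms
`(†𝕄⊛_mod)_α ⥲ (†𝕄⊛_𝔪𝔬𝔡)_α` … on the associated rational function monoids", and Example 3.6 (ii) p. 108 l. 15–17
"a natural isomorphism of Frobenioids `𝓕⊛_mod ⥲ 𝓕⊛_𝔪𝔬𝔡` that induces the identity morphism `F^×_mod → F^×_mod` on the
associated rational function monoids [cf. [FrdI], Corollary 4.10]" [claim: Mochizuki2012, status: disputed];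
[cite: MochizukiFrdI2008, Thm. 5.2(i) p.100] for the model Frobenioid vocabulary.

WHAT THIS FILE ADDS (no definition, no new object). Part 2 (`GlobalFrobenioidsFmodJunction.lean`, abc-iut-L6-t6
gen 5) built the equivalence `Prop37.fmodEquivOfSubfields : GF.Fmod ≌ Prop37.FmodModel F` (abc-iut-L5-t1's LITERAL
`†ℱ^⊛_mod = GF.Fmod` versus the [FrdI] Thm 5.2 model form of `(†𝓕⊛_mod)_α`), its arithmetic / pulled-back
specialisations `fmodJunctionAt`, `fmodJunctionAlongAt`, and recorded the rational-function clause for the functor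
`Ψ` of model Frobenioids (`unit_pointDataHom_functor_map`); abc-iut-w4-d005 recorded it for
`𝓕⊛_𝔪𝔬𝔡 ⥲ (†𝓕⊛_mod)_α` (`Prop37.unit_toModel_map`). Here the two are COMPOSED, so that the printed clause is ONE
kernel statement about the whole chain starting from abc-iut-L6-t6's category `𝓕⊛_𝔪𝔬𝔡 = Prop37.Ffrak F`
(objects = families of local fractional ideals, morphisms `(n, f)`, `f ∈ F^×`):

* `fmodEquivOfSubfields_trans_isoFrakMod_inverse` — the inverse functor of the composite equivalence
  `GF.Fmod ≌ FmodModel F ≌ Ffrak F` IS `toModel ⋙ (Ψ ⋙ equiv⁻¹)` (definitional);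
* `nonempty_iso_frak_through_junction` — followed by `†ℱ^⊛_mod ↪ †ℱ^⊛ ⥲ ℱ^⊛(†𝒟^⊚)` it is `toModel ⋙ Ψ` up to
  (a whiskering of) the counit of abc-iut-L5-t1's `GF.equiv`;
* `unit_through_junction`, `coe_pointBetaHom_apply`, `degFr_through_junction`, `div_through_junction`,
  `baseMap_through_junction` — `toModel ⋙ Ψ` sends the morphism `(n, f) : 𝔍₁ → 𝔍₂` of `𝓕⊛_𝔪𝔬𝔡` to the morphism
  of `ℱ^⊛(†𝒟^⊚)` over `𝟙_T` with Frobenius degree `n`, rational function `algebraMap F ↥(S T).L (f)` — i.e. `f`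
  ITSELF read in the number field of the terminal object `T` ("the tautological isomorphism on the associated
  rational function monoids") — and divisor the pull-back to `↥(S T).L` of the effective arithmetic divisor
  `f·𝔍₁^{⊗n}·𝔍₂^{⊗(-1)}` (`pointEtaHom`);
* `unit_through_junction_injective` / `_bijective` — the rational-function map `f ↦ algebraMap F ↥(S T).L f`
  is injective, and bijective when the field of `T` is the bottom subextension (the case of the junctions);
* the same statements AT the arithmetic junction `fmodJunctionAt` (`S` = the Galois correspondence,
  `…_arith`) and over a general `†𝒟^⊛` with `ρ : π₁(†𝒟^⊛) ↠ G_F` (`fmodJunctionAlongAt`, `…_along`).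

HONEST SCOPE. Everything here is definitional unfolding or a one-line consequence of parts 1–2; the file exists
so that [IUTchIII] Prop 3.7 (ii)'s rational-function clause is citable BY ONE NAME for the whole chain
`𝓕⊛_𝔪𝔬𝔡 → ℱ^⊛(†𝒟^⊚)` rather than as a composition of two lemmas in two files. The functor in the printed
direction `GF.Fmod ⥤ Ffrak F` is the choice-inverse of the explicit one; statements are about the explicit
inverse, as in part 2. Nothing here asserts a disputed claim or takes a side on [IUTchIII] Cor. 3.12 (typed ≠
discharged; instantiated ≠ endorsed).
-/

noncomputable section

namespace Literature.IUT.LogThetaLattice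

open CategoryTheory Opposite Function CategoryTheory.Limits
open Literature.AlgebraicGeometry.Frobenioids Literature.AlgebraicGeometry.Frobenioids.QuasiTemperoid
open Literature.IUT.HodgeTheaters

namespace Prop37

open GlobalFrobenioidModels

/-! ## §1 Over any "corresponding subfield" functor `S`, at a terminal `T` with field `⊥` -/

section Subfields

variable (F : Type) [Field F] [NumberField F]
variable {G : ProfiniteGrp.{0}} (S : BaseCat G ⥤ FinSubextCat F (Fbar F))
variable {Dcirc : Type 1} [Category.{0} Dcirc] {toBase0 : Dcirc ⥤ BaseCat G}
  (GF : GlobalFrobenioid (subfieldData F S) Dcirc toBase0) {T : BaseCat G}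

/-- The inverse functor of `†ℱ^⊛_mod ≌ (†𝓕⊛_mod)_α` (model form) is the explicit lift `Ψ ⋙ equiv⁻¹` of part 1.
([IUTchI] Ex 5.1 (iii) p.126) [claim: Mochizuki2012, status: disputed] -/
theorem fmodEquivOfSubfields_inverse (hT : IsTerminal T) (hL : (S.obj T).L = ⊥) :
    (fmodEquivOfSubfields F S GF hT hL).inverse = FmodJunction.lift GF (pointDataHom F S T) hT := rfl

/-- **The composite `†ℱ^⊛_mod ≌ (†𝓕⊛_mod)_α ≌ 𝓕⊛_𝔪𝔬𝔡` has inverse functor `toModel ⋙ (Ψ ⋙ equiv⁻¹)`** — abc-iut-L6-t6's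
comparison functor `toModel : 𝓕⊛_𝔪𝔬𝔡 ⥤ (†𝓕⊛_mod)_α` ([IUTchIII] Prop 3.7 (ii) first isomorphism, `Prop37.isoFrakMod`)
followed by the explicit lift (definitional). ([IUTchIII] Prop. 3.7 (ii) p.110) [claim: Mochizuki2012, status: disputed] -/
theorem fmodEquivOfSubfields_trans_isoFrakMod_inverse (hT : IsTerminal T) (hL : (S.obj T).L = ⊥) :
    ((fmodEquivOfSubfields F S GF hT hL).trans (isoFrakMod F).symm).inverse =
      (isoFrakMod F).functor ⋙ FmodJunction.lift GF (pointDataHom F S T) hT := rfl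

/-- **`𝓕⊛_𝔪𝔬𝔡 → †ℱ^⊛_mod ↪ †ℱ^⊛ ⥲ ℱ^⊛(†𝒟^⊚)` is `toModel ⋙ Ψ`** up to the counit of abc-iut-L5-t1's `GF.equiv`
(whiskered): the chain through the junction is the EXPLICIT functor of model data.
([IUTchIII] Prop. 3.7 (ii) p.110) [claim: Mochizuki2012, status: disputed] -/
theorem nonempty_iso_frak_through_junction (hT : IsTerminal T) (hL : (S.obj T).L = ⊥) :
    Nonempty ((((fmodEquivOfSubfields F S GF hT hL).trans (isoFrakMod F).symm).inverse ⋙ GF.fmodIncl) ⋙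
        GF.equiv.functor ≅ (isoFrakMod F).functor ⋙ (pointDataHom F S T).functor) :=
  ⟨Functor.isoWhiskerLeft ((isoFrakMod F).functor ⋙ (pointDataHom F S T).functor) GF.equiv.counitIso⟩

variable (T)

/-- **"induces the tautological isomorphism `(†𝕄⊛_mod)_α ⥲ (†𝕄⊛_𝔪𝔬𝔡)_α` on the associated rational function
monoids", end to end**: `toModel ⋙ Ψ` sends the morphism `(n, f)` of `𝓕⊛_𝔪𝔬𝔡` to a morphism of `ℱ^⊛(†𝒟^⊚)` whose
rational-function (unit) component is `f` mapped into the number field of `T` along `algebraMap F ↥(S T).L`.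
([IUTchIII] Prop. 3.7 (ii) p.110) [claim: Mochizuki2012, status: disputed] -/
theorem unit_through_junction {X Y : Ffrak F} (φ : X ⟶ Y) :
    ModelFrobenioid.unit ((pointDataHom F S T).functor.map ((isoFrakMod F).functor.map φ)) =
      pointBetaHom F S T (FrakCat.fn φ) := rfl

omit [NumberField F] in
/-- … as an element of the number field `↥(S T).L`: the unit `pointBetaHom F S T f` IS `algebraMap F ↥(S T).L (f)`,
`f ∈ F^×` the rational function of `(n, f)`. ([IUTchIII] Prop. 3.7 (ii) p.110) [claim: Mochizuki2012, status: disputed] -/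
theorem coe_pointBetaHom_apply (f : Fˣ) :
    ((pointBetaHom F S T f : (fieldAt F S T)ˣ) : fieldAt F S T) = algebraMap F (fieldAt F S T) (f : F) := rfl

/-- `toModel ⋙ Ψ` preserves Frobenius degrees: `(n, f) ↦` a morphism of Frobenius degree `n` (so linear
morphisms go to linear morphisms). ([IUTchIII] Prop. 3.7 (ii) p.110) [claim: Mochizuki2012, status: disputed] -/
theorem degFr_through_junction {X Y : Ffrak F} (φ : X ⟶ Y) :
    ModelFrobenioid.degFr ((pointDataHom F S T).functor.map ((isoFrakMod F).functor.map φ)) = FrakCat.deg φ :=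
  rfl

/-- `toModel ⋙ Ψ` on zero divisors: `(n, f) : 𝔍₁ → 𝔍₂ ↦` the pull-back to `↥(S T).L` of the effective arithmetic
divisor of the effective family `f·𝔍₁^{⊗n}·𝔍₂^{⊗(-1)}` (`homDiv`), via abc-iut-L6-t6 gen 5's `pointEtaHom`
(= `EffArithDivisor.pullback (algebraMap …) ∘ effDivHom`). ([IUTchIII] Prop. 3.7 (ii) p.110) [claim: Mochizuki2012, status: disputed] -/
theorem div_through_junction {X Y : Ffrak F} (φ : X ⟶ Y) :
    ModelFrobenioid.div ((pointDataHom F S T).functor.map ((isoFrakMod F).functor.map φ)) =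
      pointEtaHom F S T (homDiv (modelHyps F) φ) := rfl

/-- `toModel ⋙ Ψ` lands over the identity of `T` ("base category = the one-arrow category", [IUTchIII] Ex 3.6
(ii)): every morphism goes to a morphism of `ℱ^⊛(†𝒟^⊚)` with base arrow `𝟙_T`.
([IUTchIII] Prop. 3.7 (ii) p.110) [claim: Mochizuki2012, status: disputed] -/
theorem baseMap_through_junction {X Y : Ffrak F} (φ : X ⟶ Y) :
    ModelFrobenioid.baseMap ((pointDataHom F S T).functor.map ((isoFrakMod F).functor.map φ)) = 𝟙 T := rfl

/-- `toModel ⋙ Ψ` on objects: the object `𝔍` of `𝓕⊛_𝔪𝔬𝔡` goes to the object of `ℱ^⊛(†𝒟^⊚)` over `T` with class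
`η^gp(-[𝔍])` (`objCls`, `gpApp pointEta`). ([IUTchIII] Prop. 3.7 (ii) p.110) [claim: Mochizuki2012, status: disputed] -/
theorem obj_through_junction (X : Ffrak F) :
    (pointDataHom F S T).functor.obj ((isoFrakMod F).functor.obj X) =
      ⟨T, gpApp (pointEta F S T) (op pt) (objCls (modelHyps F) X)⟩ := rfl

omit [NumberField F] in
/-- The rational-function map `F^× → (↥(S T).L)^×, f ↦ algebraMap f` through the junction is INJECTIVE (a
homomorphism of fields is injective). ([IUTchIII] Prop. 3.7 (ii) p.110) [claim: Mochizuki2012, status: disputed] -/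
theorem unit_through_junction_injective : Injective (pointBetaHom F S T) := fun _ _ h =>
  Units.ext ((algebraMap F (fieldAt F S T)).injective (congrArg (fun w : (fieldAt F S T)ˣ => (w : fieldAt F S T)) h))

/-- … and BIJECTIVE when the number field of `T` is the bottom subextension `F ⊆ F̄` (the case of both
junctions: `arith_field_terminal`, `subfieldFunctor_field_terminal`) — "the tautological isomorphism
`(†𝕄⊛_mod)_α ⥲ (†𝕄⊛_𝔪𝔬𝔡)_α`" is an isomorphism of groups of rational functions.
([IUTchIII] Prop. 3.7 (ii) p.110) [claim: Mochizuki2012, status: disputed] -/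
theorem unit_through_junction_bijective (hL : (S.obj T).L = ⊥) : Bijective (pointBetaHom F S T) :=
  pointDataHom_beta_bijective F S T hL

/-- Two morphisms of `𝓕⊛_𝔪𝔬𝔡` with the same source and target and the same image through `toModel ⋙ Ψ` are
equal: the chain is FAITHFUL on `𝓕⊛_𝔪𝔬𝔡` (Frobenius degree and rational function are read off the image).
([IUTchIII] Prop. 3.7 (ii) p.110) [claim: Mochizuki2012, status: disputed] -/
theorem through_junction_faithful {X Y : Ffrak F} (φ ψ : X ⟶ Y)
    (h : (pointDataHom F S T).functor.map ((isoFrakMod F).functor.map φ) =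
      (pointDataHom F S T).functor.map ((isoFrakMod F).functor.map ψ)) : φ = ψ := by
  have hdeg : FrakCat.deg φ = FrakCat.deg ψ := by
    rw [← degFr_through_junction F S T φ, ← degFr_through_junction F S T ψ, h]
  have hfn : FrakCat.fn φ = FrakCat.fn ψ :=
    unit_through_junction_injective F S T
      (by rw [← unit_through_junction F S T φ, ← unit_through_junction F S T ψ, h])
  exact FrakCat.hom_ext hdeg hfn

end Subfields

/-! ## §2 At the arithmetic junction `fmodJunctionAt` (`S` = the Galois correspondence) -/

section Arith

variable (F : Type) [Field F] [NumberField F] {Dcirc : Type 1} [Category.{0} Dcirc]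
  {toBase0 : Dcirc ⥤ BaseCat (absGalGrp F)}
  (GF : GlobalFrobenioid (GlobalDivisorData.arith F) Dcirc toBase0)

/-- The inverse functor of `GF.Fmod ≌ FmodModel F ≌ Ffrak F` at the ARITHMETIC model is `toModel ⋙ (Ψ ⋙ equiv⁻¹)`,
`Ψ` induced by `arithPointDataHom F T` (definitional). ([IUTchIII] Prop. 3.7 (ii) p.110) [claim: Mochizuki2012, status: disputed] -/
theorem fmodJunctionAt_trans_isoFrakMod_inverse {T : BaseCat (absGalGrp F)} (hT : IsTerminal T) :
    ((fmodJunctionAt F GF hT).trans (isoFrakMod F).symm).inverse =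
      (isoFrakMod F).functor ⋙ FmodJunction.lift GF (arithPointDataHom F T) hT := rfl

/-- At the arithmetic model: `𝓕⊛_𝔪𝔬𝔡 → †ℱ^⊛_mod ↪ †ℱ^⊛ ⥲ ℱ^⊛(†𝒟^⊚)` is `toModel ⋙ Ψ` up to the counit of `GF.equiv`.
([IUTchIII] Prop. 3.7 (ii) p.110) [claim: Mochizuki2012, status: disputed] -/
theorem nonempty_iso_frak_through_junction_arith {T : BaseCat (absGalGrp F)} (hT : IsTerminal T) :
    Nonempty ((((fmodJunctionAt F GF hT).trans (isoFrakMod F).symm).inverse ⋙ GF.fmodIncl) ⋙ GF.equiv.functor ≅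
      (isoFrakMod F).functor ⋙ (arithPointDataHom F T).functor) :=
  nonempty_iso_frak_through_junction F (G := absGalGrp F) (galoisSubextOfFinite F) GF hT (arith_field_terminal F hT)

/-- **[IUTchIII] Prop 3.7 (ii), rational-function clause, END TO END at the arithmetic model**: through the
junction the morphism `(n, f)` of `𝓕⊛_𝔪𝔬𝔡` becomes a morphism of `ℱ^⊛(†𝒟^⊚)` over `𝟙_T` with Frobenius degree `n`
and rational function `pointBetaHom f = algebraMap F ↥⊥ (f)` (`coe_pointBetaHom_apply`) — `f` itself in the
number field `F = ↥⊥` of `T` — and this rational-function map `F^× → (↥⊥)^×` is BIJECTIVE. ([IUTchIII] Prop. 3.7 (ii) p.110) [claim: Mochizuki2012, status: disputed] -/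
theorem through_junction_arith (T : BaseCat (absGalGrp F)) (hT : IsTerminal T) {X Y : Ffrak F} (φ : X ⟶ Y) :
    ModelFrobenioid.degFr ((arithPointDataHom F T).functor.map ((isoFrakMod F).functor.map φ)) = FrakCat.deg φ ∧
      ModelFrobenioid.baseMap ((arithPointDataHom F T).functor.map ((isoFrakMod F).functor.map φ)) = 𝟙 T ∧
      ModelFrobenioid.unit ((arithPointDataHom F T).functor.map ((isoFrakMod F).functor.map φ)) =
        pointBetaHom F (G := absGalGrp F) (galoisSubextOfFinite F) T (FrakCat.fn φ) ∧
      Bijective (pointBetaHom F (G := absGalGrp F) (galoisSubextOfFinite F) T) :=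
  ⟨rfl, rfl, rfl, unit_through_junction_bijective F (G := absGalGrp F) (galoisSubextOfFinite F) T
    (arith_field_terminal F hT)⟩

end Arith

/-! ## §3 Over a general `†𝒟^⊛ = ℬ(G)⁰` with `ρ : π₁(†𝒟^⊛) ↠ G_F` (`fmodJunctionAlongAt`) -/

section Along

variable (F : Type) [Field F] [NumberField F] {G : ProfiniteGrp.{0}} (ρ : G →ₜ* GalFbar F) (hρ : Surjective ρ)
variable {Dcirc : Type 1} [Category.{0} Dcirc] {toBase0 : Dcirc ⥤ BaseCat G}
  (GF : GlobalFrobenioid (GlobalDivisorData.arithAlong F ρ hρ) Dcirc toBase0)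

/-- The inverse functor of `GF.Fmod ≌ FmodModel F ≌ Ffrak F` over a general `†𝒟^⊛` is `toModel ⋙ (Ψ ⋙ equiv⁻¹)`,
`Ψ` induced by `pointDataHom F (subfieldFunctor F ρ hρ) T` (definitional). ([IUTchIII] Prop. 3.7 (ii) p.110)
[claim: Mochizuki2012, status: disputed] -/
theorem fmodJunctionAlongAt_trans_isoFrakMod_inverse {T : BaseCat G} (hT : IsTerminal T) :
    ((fmodJunctionAlongAt F ρ hρ GF hT).trans (isoFrakMod F).symm).inverse =
      (isoFrakMod F).functor ⋙ FmodJunction.lift GF (pointDataHom F (G := G) (subfieldFunctor F ρ hρ) T) hT :=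
  rfl

/-- Over a general `†𝒟^⊛`: `𝓕⊛_𝔪𝔬𝔡 → †ℱ^⊛_mod ↪ †ℱ^⊛ ⥲ ℱ^⊛(†𝒟^⊚)` is `toModel ⋙ Ψ` up to the counit of `GF.equiv`.
([IUTchIII] Prop. 3.7 (ii) p.110) [claim: Mochizuki2012, status: disputed] -/
theorem nonempty_iso_frak_through_junction_along {T : BaseCat G} (hT : IsTerminal T) :
    Nonempty ((((fmodJunctionAlongAt F ρ hρ GF hT).trans (isoFrakMod F).symm).inverse ⋙ GF.fmodIncl) ⋙
        GF.equiv.functor ≅ (isoFrakMod F).functor ⋙ (pointDataHom F (G := G) (subfieldFunctor F ρ hρ) T).functor) :=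
  nonempty_iso_frak_through_junction F (G := G) (subfieldFunctor F ρ hρ) GF hT
    (subfieldFunctor_field_terminal F ρ hρ hT)

/-- **[IUTchIII] Prop 3.7 (ii), rational-function clause, END TO END over a general `†𝒟^⊛`**: through the
junction the morphism `(n, f)` of `𝓕⊛_𝔪𝔬𝔡` becomes a morphism of `ℱ^⊛(†𝒟^⊚)` over `𝟙_T` with Frobenius degree `n`
and rational function `pointBetaHom f = algebraMap F ↥⊥ (f)` — the field of the terminal object `T` being
`⊥ = F` (`subfieldFunctor_field_terminal`) — and the rational-function map is BIJECTIVE.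
([IUTchIII] Prop. 3.7 (ii) p.110) [claim: Mochizuki2012, status: disputed] -/
theorem through_junction_along (T : BaseCat G) (hT : IsTerminal T) {X Y : Ffrak F} (φ : X ⟶ Y) :
    ModelFrobenioid.degFr ((pointDataHom F (G := G) (subfieldFunctor F ρ hρ) T).functor.map
        ((isoFrakMod F).functor.map φ)) = FrakCat.deg φ ∧
      ModelFrobenioid.baseMap ((pointDataHom F (G := G) (subfieldFunctor F ρ hρ) T).functor.map
        ((isoFrakMod F).functor.map φ)) = 𝟙 T ∧
      ModelFrobenioid.unit ((pointDataHom F (G := G) (subfieldFunctor F ρ hρ) T).functor.map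
          ((isoFrakMod F).functor.map φ)) = pointBetaHom F (G := G) (subfieldFunctor F ρ hρ) T (FrakCat.fn φ) ∧
      Bijective (pointBetaHom F (G := G) (subfieldFunctor F ρ hρ) T) :=
  ⟨rfl, rfl, rfl, unit_through_junction_bijective F (G := G) (subfieldFunctor F ρ hρ) T
    (subfieldFunctor_field_terminal F ρ hρ hT)⟩

end Along

end Prop37

end Literature.IUT.LogThetaLattice

end
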